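import Mathlib.GroupTheory.Nilpotent
import Mathlib.GroupTheory.PGroup
import Mathlib.GroupTheory.Abelianization.Defs
import Mathlib.Data.List.OfFn
import HarnessLib

/-!
# Commutator width in finitely generated nilpotent groups; the shape of the Frattini words in a finite `p`-group

J. D. Dixon, M. P. F. du Sautoy, A. Mann, D. Segal, *Analytic pro-`p` groups* (2nd ed., CUP 1999),
Ch. 1: the elementary lemma behind Serre's theorem on subgroups of finite index in finitely generated
pro-`p` groups (op. cit. Thm. 1.17; J.-P. Serre, *Galois Cohomology*, I §4.2, exercise 6):

* `exists_eq_prod_commutator_of_isNilpotent` — if a NILPOTENT group `G` is generated by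
  `a₁, …, a_d`, then every element of the derived subgroup `[G, G]` is a product
  `⁅a₁, g₁⁆ ⋯ ⁅a_d, g_d⁆` of `d` commutators with the generators (induction on the lower central
  series: modulo `γ_{n+2}` the commutators `⁅γ_n, G⁆` are central and bilinear).
* `exists_eq_pow_mul_prod_commutator_of_isPGroup` — consequently, in a finite `p`-group generated by
  `a₁, …, a_d`, every element of the (abstract) subgroup generated by the `p`-th powers and the
  commutators is of the form `x^p · ⁅a₁, g₁⁆ ⋯ ⁅a_d, g_d⁆`.

These give the UNIFORM bound (in terms of `d` only) on the length of Frattini words that makes the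
abstract Frobenius/Frattini subgroup of a topologically finitely generated pro-`p` group closed (sibling
file `ProPFrattiniOpen.lean`).  Pure group theory over Mathlib; proof-only (no definitions).
[cite: DixonDuSautoyMannSegal1999, Ch. 1, Prop. 1.16–1.19, Thm. 1.17]
-/

namespace Literature.GroupTheory.Nilpotent

open Subgroup
open scoped commutatorElement

universe u

section Lists

variable {M : Type u} [Monoid M]

/-- A list product `∏ᵢ φᵢ(δ_{ij} x)` over `Fin d` in a (noncommutative) monoid, where `φᵢ 1 = 1`,
collapses to the single factor `φ_j x`. [cite: DixonDuSautoyMannSegal1999, Ch. 1 Prop. 1.16] -/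
theorem prod_ofFn_mulSingle {d : ℕ} (j : Fin d) (x : M) (φ : Fin d → M → M)
    (hφ : ∀ i, φ i 1 = 1) :
    (List.ofFn fun i => φ i ((Pi.mulSingle j x : Fin d → M) i)).prod = φ j x := by
  classical
  induction d with
  | zero => exact j.elim0
  | succ d ih =>
    rw [List.ofFn_succ, List.prod_cons]
    refine Fin.cases ?_ (fun k => ?_) j
    · -- j = 0
      have h0 : (Pi.mulSingle (0 : Fin (d + 1)) x : Fin (d + 1) → M) 0 = x := Pi.mulSingle_eq_same _ _
      have hrest : (List.ofFn fun i : Fin d =>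
          φ i.succ ((Pi.mulSingle (0 : Fin (d + 1)) x : Fin (d + 1) → M) i.succ)).prod = 1 := by
        apply List.prod_eq_one
        intro y hy
        rw [List.mem_ofFn] at hy
        obtain ⟨i, rfl⟩ := hy
        rw [Pi.mulSingle_eq_of_ne (Fin.succ_ne_zero i), hφ]
      rw [h0, hrest, mul_one]
    · -- j = k.succ
      have h0 : (Pi.mulSingle (k.succ : Fin (d + 1)) x : Fin (d + 1) → M) 0 = 1 :=
        Pi.mulSingle_eq_of_ne (Fin.succ_ne_zero k).symm _
      have hrest : (fun i : Fin d =>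
          φ i.succ ((Pi.mulSingle (k.succ : Fin (d + 1)) x : Fin (d + 1) → M) i.succ))
          = fun i : Fin d => (fun i' => φ i'.succ) i ((Pi.mulSingle k x : Fin d → M) i) := by
        funext i
        by_cases hik : i = k
        · subst hik
          rw [Pi.mulSingle_eq_same, Pi.mulSingle_eq_same]
        · rw [Pi.mulSingle_eq_of_ne hik, Pi.mulSingle_eq_of_ne]
          exact fun h => hik (Fin.succ_injective _ h)
      rw [h0, hφ, one_mul, hrest, ih k (fun i' => φ i'.succ) (fun i' => hφ i'.succ)]

variable {Q : Type u} [Group Q]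

/-- In a group, `∏ᵢ (bᵢ cᵢ) = (∏ᵢ bᵢ)(∏ᵢ cᵢ)` (ordered list products over `Fin d`) as soon as all the
`cᵢ` are central. [cite: DixonDuSautoyMannSegal1999, Ch. 1 Prop. 1.16] -/
theorem prod_ofFn_mul_of_mem_center {d : ℕ} (b c : Fin d → Q) (hc : ∀ i, c i ∈ Subgroup.center Q) :
    (List.ofFn fun i => b i * c i).prod = (List.ofFn b).prod * (List.ofFn c).prod := by
  induction d with
  | zero => simp
  | succ d ih =>
    rw [List.ofFn_succ, List.ofFn_succ, List.ofFn_succ, List.prod_cons, List.prod_cons,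
      List.prod_cons, ih (fun i => b i.succ) (fun i => c i.succ) (fun i => hc i.succ)]
    set B := (List.ofFn fun i : Fin d => b i.succ).prod
    set C := (List.ofFn fun i : Fin d => c i.succ).prod
    have hcomm : c 0 * B = B * c 0 := (Subgroup.mem_center_iff.mp (hc 0) B).symm
    calc b 0 * c 0 * (B * C) = b 0 * (c 0 * B) * C := by simp only [mul_assoc]
      _ = b 0 * (B * c 0) * C := by rw [hcomm]
      _ = b 0 * B * (c 0 * C) := by simp only [mul_assoc]

end Lists

section Nilpotent

variable {G : Type u} [Group G] {d : ℕ} (a : Fin d → G)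

/-- Modulo `γ_{n+1}(G)`, the elements of `γ_n(G)` are central. [cite: DixonDuSautoyMannSegal1999, Ch. 1 Prop. 1.16] -/
theorem mk_mem_center_of_mem_lowerCentralSeries (n : ℕ) {c : G}
    (hc : c ∈ (⊤ : Subgroup G).lowerCentralSeries n) :
    (QuotientGroup.mk c : G ⧸ (⊤ : Subgroup G).lowerCentralSeries (n + 1)) ∈
      Subgroup.center (G ⧸ (⊤ : Subgroup G).lowerCentralSeries (n + 1)) := by
  rw [Subgroup.mem_center_iff]
  intro q
  obtain ⟨x, rfl⟩ := QuotientGroup.mk_surjective q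
  rw [← QuotientGroup.mk_mul, ← QuotientGroup.mk_mul, QuotientGroup.eq]
  have h : ⁅c⁻¹, x⁻¹⁆ ∈ (⊤ : Subgroup G).lowerCentralSeries (n + 1) := by
    rw [Subgroup.lowerCentralSeries_succ]
    exact Subgroup.commutator_mem_commutator (inv_mem hc) (Subgroup.mem_top _)
  have hx : (x * c)⁻¹ * (c * x) = ⁅c⁻¹, x⁻¹⁆ := by
    rw [commutatorElement_def]; group
  rwa [hx]

/-- `⁅aᵢ, w⁆ ∈ γ_{m+1}` for `w ∈ γ_m`. [cite: DixonDuSautoyMannSegal1999, Ch. 1 Prop. 1.16] -/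
theorem commutatorElement_mem_lowerCentralSeries_succ (m : ℕ) (x : G) {w : G}
    (hw : w ∈ (⊤ : Subgroup G).lowerCentralSeries m) :
    ⁅x, w⁆ ∈ (⊤ : Subgroup G).lowerCentralSeries (m + 1) := by
  rw [Subgroup.lowerCentralSeries_succ, ← inv_mem_iff, commutatorElement_inv]
  exact Subgroup.commutator_mem_commutator hw (Subgroup.mem_top _)

/-- MERGING modulo `γ_{m+2}`: if all `wᵢ ∈ γ_m`, then
`∏ᵢ ⁅aᵢ, fᵢ wᵢ⁆ ≡ (∏ᵢ ⁅aᵢ, fᵢ⁆)(∏ᵢ ⁅aᵢ, wᵢ⁆)`. [cite: DixonDuSautoyMannSegal1999, Ch. 1 Prop. 1.16] -/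
theorem mk_prod_commutator_mul (m : ℕ) (f w : Fin d → G)
    (hw : ∀ i, w i ∈ (⊤ : Subgroup G).lowerCentralSeries m) :
    (QuotientGroup.mk (List.ofFn fun i => ⁅a i, f i * w i⁆).prod :
        G ⧸ (⊤ : Subgroup G).lowerCentralSeries (m + 1 + 1)) =
      QuotientGroup.mk (List.ofFn fun i => ⁅a i, f i⁆).prod *
        QuotientGroup.mk (List.ofFn fun i => ⁅a i, w i⁆).prod := by
  set N := (⊤ : Subgroup G).lowerCentralSeries (m + 1 + 1)
  have hcen : ∀ i, (QuotientGroup.mk ⁅a i, w i⁆ : G ⧸ N) ∈ Subgroup.center (G ⧸ N) := fun i =>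
    mk_mem_center_of_mem_lowerCentralSeries (m + 1)
      (commutatorElement_mem_lowerCentralSeries_succ m (a i) (hw i))
  have hmap : ∀ h : Fin d → G, (QuotientGroup.mk (List.ofFn h).prod : G ⧸ N) =
      (List.ofFn fun i => (QuotientGroup.mk (h i) : G ⧸ N)).prod := by
    intro h
    rw [← QuotientGroup.mk'_apply, map_list_prod, List.map_ofFn]
    rfl
  rw [hmap, hmap, hmap, ← prod_ofFn_mul_of_mem_center _ _ hcen]
  refine congrArg List.prod (congrArg List.ofFn (funext fun i => ?_))
  -- `⁅a, f w⁆ = ⁅a, f⁆ · f ⁅a, w⁆ f⁻¹` and the conjugate of the central class is itself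
  have hid : ⁅a i, f i * w i⁆ = ⁅a i, f i⁆ * (f i * ⁅a i, w i⁆ * (f i)⁻¹) := by
    simp only [commutatorElement_def]; group
  rw [hid, QuotientGroup.mk_mul, QuotientGroup.mk_mul, QuotientGroup.mk_mul, QuotientGroup.mk_inv]
  congr 1
  have hc := Subgroup.mem_center_iff.mp (hcen i) (QuotientGroup.mk (f i) : G ⧸ N)
  rw [hc, mul_inv_cancel_right]

/-- The set of `z` congruent modulo `γ_{m+2}` to a product `∏ᵢ ⁅aᵢ, wᵢ⁆` with all `wᵢ ∈ γ_m` contains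
`γ_{m+1} = ⁅γ_m, G⁆`, provided the `aᵢ` generate `G`. [cite: DixonDuSautoyMannSegal1999, Ch. 1 Prop. 1.16] -/
theorem exists_prod_commutator_mk_eq (ha : Subgroup.closure (Set.range a) = ⊤) (m : ℕ) {z : G}
    (hz : z ∈ (⊤ : Subgroup G).lowerCentralSeries (m + 1)) :
    ∃ w : Fin d → G, (∀ i, w i ∈ (⊤ : Subgroup G).lowerCentralSeries m) ∧
      (QuotientGroup.mk (List.ofFn fun i => ⁅a i, w i⁆).prod :
        G ⧸ (⊤ : Subgroup G).lowerCentralSeries (m + 1 + 1)) = QuotientGroup.mk z := by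
  classical
  set N := (⊤ : Subgroup G).lowerCentralSeries (m + 1 + 1) with hN
  -- the predicate
  let T : G → Prop := fun z => ∃ w : Fin d → G, (∀ i, w i ∈ (⊤ : Subgroup G).lowerCentralSeries m) ∧
    (QuotientGroup.mk (List.ofFn fun i => ⁅a i, w i⁆).prod : G ⧸ N) = QuotientGroup.mk z
  -- closure properties of `T`
  have T_congr : ∀ {z z' : G}, (QuotientGroup.mk z : G ⧸ N) = QuotientGroup.mk z' → T z → T z' := by
    rintro z z' h ⟨w, hw, hwz⟩
    exact ⟨w, hw, hwz.trans h⟩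
  have T_one : T 1 := by
    refine ⟨fun _ => 1, fun _ => one_mem _, ?_⟩
    simp only [commutatorElement_one_right, List.ofFn_const, List.prod_replicate, one_pow, QuotientGroup.mk_one]
  have T_mul : ∀ {z₁ z₂ : G}, T z₁ → T z₂ → T (z₁ * z₂) := by
    rintro z₁ z₂ ⟨w₁, hw₁, h₁⟩ ⟨w₂, hw₂, h₂⟩
    refine ⟨fun i => w₁ i * w₂ i, fun i => mul_mem (hw₁ i) (hw₂ i), ?_⟩
    rw [mk_prod_commutator_mul a m w₁ w₂ hw₂, h₁, h₂, QuotientGroup.mk_mul]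
  have T_inv : ∀ {z : G}, T z → T z⁻¹ := by
    rintro z ⟨w, hw, h⟩
    refine ⟨fun i => (w i)⁻¹, fun i => inv_mem (hw i), ?_⟩
    have hm := mk_prod_commutator_mul a m w (fun i => (w i)⁻¹) (fun i => inv_mem (hw i))
    have h1 : (List.ofFn fun i => ⁅a i, w i * (w i)⁻¹⁆).prod = 1 := by
      simp only [mul_inv_cancel, commutatorElement_one_right, List.ofFn_const, List.prod_replicate,
        one_pow]
    rw [h1, QuotientGroup.mk_one, h] at hm
    rw [QuotientGroup.mk_inv]
    exact eq_inv_of_mul_eq_one_right hm.symm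
  -- generators `⁅p, q⁆`, `p ∈ γ_m`, `q ∈ G`: induction on `q` over the generators `aᵢ`
  have T_gen : ∀ q : G, ∀ p ∈ (⊤ : Subgroup G).lowerCentralSeries m, T ⁅p, q⁆ := by
    intro q
    have hq : q ∈ Subgroup.closure (Set.range a) := by rw [ha]; exact Subgroup.mem_top q
    induction hq using Subgroup.closure_induction with
    | mem x hx =>
      obtain ⟨j, rfl⟩ := hx
      intro p hp
      -- `⁅p, a_j⁆ = ⁅a_j, p⁆⁻¹` and `⁅a_j, p⁆ = ∏ᵢ ⁅aᵢ, δᵢⱼ p⁆`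
      have hT : T ⁅a j, p⁆ := by
        refine ⟨Pi.mulSingle j p, fun i => ?_, ?_⟩
        · by_cases hij : i = j
          · subst hij; rw [Pi.mulSingle_eq_same]; exact hp
          · rw [Pi.mulSingle_eq_of_ne hij]; exact one_mem _
        · rw [prod_ofFn_mulSingle j p (fun i x => ⁅a i, x⁆) (fun i => commutatorElement_one_right _)]
      rw [← commutatorElement_inv]
      exact T_inv hT
    | one => intro p _; rw [commutatorElement_one_right]; exact T_one
    | mul x y _ _ hx hy =>
      intro p hp
      have hid : ⁅p, x * y⁆ = ⁅p, x⁆ * (x * ⁅p, y⁆ * x⁻¹) := by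
        simp only [commutatorElement_def]; group
      rw [hid]
      refine T_mul (hx p hp) (T_congr ?_ (hy p hp))
      have hcen : (QuotientGroup.mk ⁅p, y⁆ : G ⧸ N) ∈ Subgroup.center (G ⧸ N) :=
        mk_mem_center_of_mem_lowerCentralSeries (m + 1) (by
          rw [Subgroup.lowerCentralSeries_succ]
          exact Subgroup.commutator_mem_commutator hp (Subgroup.mem_top _))
      have hc := Subgroup.mem_center_iff.mp hcen (QuotientGroup.mk x : G ⧸ N)
      rw [QuotientGroup.mk_mul, QuotientGroup.mk_mul, QuotientGroup.mk_inv, hc, mul_inv_cancel_right]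
    | inv x _ hx =>
      intro p hp
      have hid : ⁅p, x⁻¹⁆ = x⁻¹ * ⁅x, p⁆ * x := by
        simp only [commutatorElement_def]; group
      rw [hid]
      have hT : T ⁅x, p⁆ := by rw [← commutatorElement_inv]; exact T_inv (hx p hp)
      refine T_congr ?_ hT
      have hcen : (QuotientGroup.mk ⁅x, p⁆ : G ⧸ N) ∈ Subgroup.center (G ⧸ N) :=
        mk_mem_center_of_mem_lowerCentralSeries (m + 1)
          (commutatorElement_mem_lowerCentralSeries_succ m x hp)
      have hc := Subgroup.mem_center_iff.mp hcen (QuotientGroup.mk x⁻¹ : G ⧸ N)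
      rw [QuotientGroup.mk_mul, QuotientGroup.mk_mul, hc, QuotientGroup.mk_inv, inv_mul_cancel_right]
  -- now induct over `z ∈ γ_{m+1} = closure {⁅p, q⁆}`
  rw [Subgroup.lowerCentralSeries_succ, Subgroup.commutator_def] at hz
  induction hz using Subgroup.closure_induction with
  | mem x hx =>
    obtain ⟨p, hp, q, -, rfl⟩ := hx
    exact T_gen q p hp
  | one => exact T_one
  | mul x y _ _ hx hy => exact T_mul hx hy
  | inv x _ hx => exact T_inv hx

/-- **Commutator width `d` in a `d`-generator nilpotent group.** If `G` is nilpotent and generated by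
`a₁, …, a_d`, every element of `[G, G]` is a product `⁅a₁, g₁⁆ ⋯ ⁅a_d, g_d⁆`.
[cite: DixonDuSautoyMannSegal1999, Ch. 1 Prop. 1.16] -/
theorem exists_eq_prod_commutator_of_isNilpotent [Group.IsNilpotent G]
    (ha : Subgroup.closure (Set.range a) = ⊤) {g : G} (hg : g ∈ commutator G) :
    ∃ f : Fin d → G, g = (List.ofFn fun i => ⁅a i, f i⁆).prod := by
  -- `P k`: `g ≡ ∏ ⁅aᵢ, fᵢ⁆ (mod γ_{k+1})`
  have key : ∀ k : ℕ, ∃ f : Fin d → G,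
      ((List.ofFn fun i => ⁅a i, f i⁆).prod)⁻¹ * g ∈ (⊤ : Subgroup G).lowerCentralSeries (k + 1) := by
    intro k
    induction k with
    | zero =>
      refine ⟨fun _ => 1, ?_⟩
      simpa only [commutatorElement_one_right, List.ofFn_const, List.prod_replicate, one_pow, inv_one,
        one_mul, ← top_lowerCentralSeries_one] using hg
    | succ k ih =>
      obtain ⟨f, hf⟩ := ih
      obtain ⟨w, hw, hwz⟩ := exists_prod_commutator_mk_eq a ha k hf
      refine ⟨fun i => f i * w i, ?_⟩
      rw [← QuotientGroup.eq, mk_prod_commutator_mul a k f w hw, hwz, ← QuotientGroup.mk_mul,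
        mul_inv_cancel_left]
  obtain ⟨f, hf⟩ := key (Group.nilpotencyClass G)
  refine ⟨f, ?_⟩
  have hbot : (⊤ : Subgroup G).lowerCentralSeries (Group.nilpotencyClass G + 1) = ⊥ :=
    le_bot_iff.mp (Subgroup.lowerCentralSeries_nilpotencyClass (G := G) ▸
      Subgroup.lowerCentralSeries_antitone ⊤ (Nat.le_succ _))
  rw [hbot, Subgroup.mem_bot, inv_mul_eq_one] at hf
  exact hf.symm

end Nilpotent

section PGroup

variable {G : Type u} [Group G] {d : ℕ} (a : Fin d → G)

/-- **Shape of the Frattini words in a finite `p`-group.** If `G` is a finite `p`-group generated by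
`a₁, …, a_d`, every element of the subgroup generated by all `p`-th powers and all commutators is of
the form `x^p · ⁅a₁, g₁⁆ ⋯ ⁅a_d, g_d⁆`. [cite: DixonDuSautoyMannSegal1999, Ch. 1 Prop. 1.16] -/
theorem exists_eq_pow_mul_prod_commutator_of_isPGroup [Finite G] {p : ℕ} [Fact p.Prime]
    (hG : IsPGroup p G) (ha : Subgroup.closure (Set.range a) = ⊤) {g : G}
    (hg : g ∈ Subgroup.closure ({x : G | ∃ y : G, y ^ p = x} ∪ {x : G | ∃ y z : G, ⁅y, z⁆ = x})) :
    ∃ (x : G) (f : Fin d → G), g = x ^ p * (List.ofFn fun i => ⁅a i, f i⁆).prod := by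
  haveI : Group.IsNilpotent G := hG.isNilpotent
  -- in the abelianization, `g` is a `p`-th power
  let π : G →* Abelianization G := Abelianization.of
  have hπ : π g ∈ (powMonoidHom p : Abelianization G →* Abelianization G).range := by
    have hle : (Subgroup.closure ({x : G | ∃ y : G, y ^ p = x} ∪ {x : G | ∃ y z : G, ⁅y, z⁆ = x})).map π
        ≤ (powMonoidHom p : Abelianization G →* Abelianization G).range := by
      rw [MonoidHom.map_closure, Subgroup.closure_le]
      rintro _ ⟨x, hx, rfl⟩
      rcases hx with ⟨y, rfl⟩ | ⟨y, z, rfl⟩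
      · exact ⟨π y, by rw [powMonoidHom_apply, map_pow]⟩
      · refine ⟨1, ?_⟩
        rw [powMonoidHom_apply, one_pow, eq_comm, ← MonoidHom.mem_ker, Abelianization.ker_of]
        exact Subgroup.commutator_mem_commutator (Subgroup.mem_top y) (Subgroup.mem_top z)
    exact hle (Subgroup.mem_map_of_mem π hg)
  obtain ⟨ybar, hy⟩ := hπ
  obtain ⟨x, rfl⟩ := QuotientGroup.mk_surjective ybar
  rw [powMonoidHom_apply] at hy
  have hmem : (x ^ p)⁻¹ * g ∈ commutator G := by
    rw [← Abelianization.ker_of, MonoidHom.mem_ker, map_mul, map_inv, map_pow, inv_mul_eq_one]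
    exact hy
  obtain ⟨f, hf⟩ := exists_eq_prod_commutator_of_isNilpotent a ha hmem
  exact ⟨x, f, by rw [← hf, mul_inv_cancel_left]⟩

end PGroup

end Literature.GroupTheory.Nilpotent
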